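import Summits.PneNP.PneNP.Theses.ExpanderLinearGenerators
import Summits.PneNP.PneNP.Theorems.ExpanderLinearGeneratorsExpansionForcesDepthFregeSize
import Summits.PneNP.PneNP.Theorems.ExpanderLinearGeneratorsLinearGeneratorDepthFregeHardDepthFloor

/-!
# PneNP / ExpanderLinearGenerators — where the content of `ExpansionForcesDepthFregeSize` lives
(stmt-PneNP-11442, second helper file)

Route `PneNP/ExpanderLinearGenerators`, support item stmt-PneNP-11442
(`Summit.PneNP.PneNP.Theses.ExpanderLinearGenerators.ExpansionForcesDepthFregeSize`).
The item quantifies over a locality `ℓ ≥ 1` and a depth `d`. Two slices are settled vacuously: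

* localities `ℓ ≤ 7` (`expansionForcesDepthFregeSize_of_le_seven`, first helper file: an
  `ℓ`-sparse `(r, 3/4 · ℓ)`-boundary expander with `ℓ ≤ 7`, `r ≥ 1 + ℓ + ℓ²` is solvable), and
* depths `d ≤ 6` (`expansionForcesDepthFregeSize_of_depth_le_six` below, from the depth floor
  `not_isDepthProofOf_of_le_six` of the sibling item stmt-PneNP-11443: the XOR-CNF of an
  expanding unsolvable system has no `textbookFrege` proof of alternation depth `≤ 6`).

`expansionForcesDepthFregeSize_iff_eight_le_seven_le` records the reduction: the item is
equivalent to its restriction to `ℓ ≥ 8` and `d ≥ 7`. From `ℓ = 9` on, linear-size unsolvable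
`(r, 3/4 · ℓ)`-boundary expanders exist (e.g. Tseitin systems of suitable `ℓ`-regular graphs on
`Θ(r)` vertices), so there the item is a genuine depth-`d` Frege lower bound — in print only at
column weight `2` (Galesi–Itsykson–Riazanov–Sofronova 2023 via treewidth, Håstad 2020) and open in
the hypergraph generality the item asks for; through the proved glue
`ExpansionGivesLinearGeneratorHard` it implies Krajíček's Problem 19.4.5 (item stmt-PneNP-11443).
-/

namespace Summit.PneNP.PneNP.Theorems

set_option linter.dupNamespace false -- `Summit.PneNP.PneNP.…`: summit = sub-problem (D-0017)

open Literature.Computability.MetaComplexity Literature.Computability.Complexity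

/-- **The `d ≤ 6` slice of `ExpansionForcesDepthFregeSize` holds** (vacuously: with `R = 2` the
XOR-CNF of an `ℓ`-sparse `(r, 3/4 · ℓ)`-boundary-expanding unsolvable system, `r ≥ 2`, has no
`textbookFrege` proof of alternation depth `≤ 6`, `not_isDepthProofOf_of_le_six`). [folklore] -/
theorem expansionForcesDepthFregeSize_of_depth_le_six (ℓ d : ℕ) (hℓ1 : 1 ≤ ℓ) (hd : d ≤ 6) :
    ∃ ε : ℝ, 0 < ε ∧ ∃ R : ℝ, ∀ r : ℝ, R ≤ r → ∀ (n m : ℕ) (E : Fin m → LinEqMod 2 n),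
      (∀ i, (E i).supp.card ≤ ℓ) →
      IsBoundaryExpander (fun i => (E i).supp.map Fin.valEmbedding) r (3 / 4 * ℓ) →
      ¬ SystemSat E Finset.univ →
      ∀ π : List (PropForm ℕ), textbookFrege.IsDepthProofOf d π
        (PropForm.neg (PropForm.ofCNF (sumEncoding 1 E))) →
      (2 : ℝ) ^ (r ^ ε) ≤ (proofSize π : ℝ) :=
  ⟨1, one_pos, 2, fun _r hr _n _m E hsparse hexp hunsat π hπ =>
    absurd hπ (not_isDepthProofOf_of_le_six E hℓ1 hr hd hsparse hexp hunsat π)⟩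

open Summit.PneNP.PneNP.Theses.ExpanderLinearGenerators in
/-- **Reduction of `ExpansionForcesDepthFregeSize` to localities `ℓ ≥ 8` and depths `d ≥ 7`.**
Item stmt-PneNP-11442 is equivalent to its restriction to `8 ≤ ℓ` and `7 ≤ d`: the localities
`ℓ ≤ 7` are settled by `expansionForcesDepthFregeSize_of_le_seven` (no unsolvable expander
exists) and the depths `d ≤ 6` by `expansionForcesDepthFregeSize_of_depth_le_six` (no proof of
that depth exists). [folklore] -/
theorem expansionForcesDepthFregeSize_iff_eight_le_seven_le :
    ExpansionForcesDepthFregeSize ↔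
    ∀ (ℓ d : ℕ), 8 ≤ ℓ → 7 ≤ d → ∃ ε : ℝ, 0 < ε ∧ ∃ R : ℝ, ∀ r : ℝ, R ≤ r →
      ∀ (n m : ℕ) (E : Fin m → LinEqMod 2 n),
      (∀ i, (E i).supp.card ≤ ℓ) →
      IsBoundaryExpander (fun i => (E i).supp.map Fin.valEmbedding) r (3 / 4 * ℓ) →
      ¬ SystemSat E Finset.univ →
      ∀ π : List (PropForm ℕ), textbookFrege.IsDepthProofOf d π
        (PropForm.neg (PropForm.ofCNF (sumEncoding 1 E))) →
      (2 : ℝ) ^ (r ^ ε) ≤ (proofSize π : ℝ) := by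
  refine ⟨fun h ℓ d hℓ _ => h ℓ d (by omega), fun h ℓ d hℓ1 => ?_⟩
  by_cases hℓ : ℓ ≤ 7
  · exact expansionForcesDepthFregeSize_of_le_seven ℓ d hℓ1 hℓ
  by_cases hd : d ≤ 6
  · exact expansionForcesDepthFregeSize_of_depth_le_six ℓ d hℓ1 hd
  exact h ℓ d (by omega) (by omega)

end Summit.PneNP.PneNP.Theorems
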